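import Summits.KontsevichZagierPeriods.KontsevichZagierPeriods.Theorems.TerasomaMultiplicationBetaCancellationStubFibreSubstitutionAE
import Summits.KontsevichZagierPeriods.KontsevichZagierPeriods.Theorems.TerasomaMultiplicationBetaCancellationStubCatalystAlgebraicPoint

/-!
# `BetaCancellation` (stmt-KontsevichZagierPeriods-13633), line `dirichlet-companion-to-pi` — stub `stub_catalyticDomainAdd`

**Catalytic domain additivity descends.** Let `p = [K, g]` be a catalyst of dimension `d` with
`p.value = ∫_K g ≠ 0`, and let `P n r = p ⊗ r` be a pinned-product family in the crux's coordinates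
(catalyst first, `Fin.castAdd n i`; factor last, `Fin.natAdd d j`): the domain of `P n r` is the
cylinder `{z | head z ∈ K ∧ tail z ∈ r.domain}` and its integrand is `g (head z) · r.integrand (tail z)`.
If `(P n r, P n r₁, P n r₂)` is a domain-additivity instance of the KZ calculus (the four hypotheses
of `KZ.domainAddRel`: union of domains, Lebesgue-null overlap, integrands agreeing on the two pieces),
then so is `(r, r₁, r₂)`; in particular `[r] − [r₁] − [r₂] ∈ KZ.relations`.

Proof. Pick a catalyst point `x₀ ∈ K` with `g x₀ ≠ 0` (`stub_catalyst_algebraicPoint`). Slicing the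
three cylinders at `x₀` (`Fin.append x₀ w ∈ (P n s).domain ↔ w ∈ s.domain`) turns the union of
domains upstairs into `r.domain = r₁.domain ∪ r₂.domain`, and the integrand identities upstairs, read
at `Fin.append x₀ w`, into `g x₀ · f w = g x₀ · fᵢ w`, whence `f = fᵢ` on `rᵢ.domain`
(`mul_left_cancel₀`). The overlap upstairs is the cylinder `K × (r₁.domain ∩ r₂.domain)`, of volume
`vol K · vol (r₁.domain ∩ r₂.domain)` (transport along the volume-preserving
`KZ.appendMeasurableEquiv`, `Measure.prod_prod`); it is null and `vol K ≠ 0` (else `p.value = 0`), so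
the overlap downstairs is null. No definitions; sorry-free;
axioms ⊆ {propext, Classical.choice, Quot.sound}.

References: M. Kontsevich, D. Zagier, *Periods* (2001), §1.2 rule (1), §4.1 ("Fubini formula").
-/

noncomputable section

-- `Summit.KontsevichZagierPeriods.KontsevichZagierPeriods.…` is the tree's mandated layout (single-conjunct summit).
set_option linter.dupNamespace false

namespace Summit.KontsevichZagierPeriods.KontsevichZagierPeriods.BetaCancellationLine

open MeasureTheory Set
open Literature.NumberTheory.Transcendental
open Literature.NumberTheory.Transcendental.KZ

/-! ### Two measure-theoretic helpers -/

/-- The domain of an integral representation of non-zero value has non-zero volume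
(`∫_K g = 0` when `K` is null). [folklore] -/
theorem catalyticDomainAdd_volume_domain_ne_zero {d : ℕ} (p : IntegralRep d) (hp : p.value ≠ 0) :
    volume p.domain ≠ 0 :=
  fun h => hp (setIntegral_measure_zero p.integrand h)

/-- The volume of a cylinder `K × B ⊆ ℝ^{d+n}` (image of `K ×ˢ B` under `Fin.append`) is
`vol K · vol B`: transport along the volume-preserving `KZ.appendMeasurableEquiv` and
`Measure.prod_prod`. [folklore] -/
theorem catalyticDomainAdd_volume_image_prod {d n : ℕ} (K : Set (Fin d → ℝ)) (B : Set (Fin n → ℝ)) :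
    volume (appendMeasurableEquiv d n '' (K ×ˢ B)) = volume K * volume B := by
  rw [MeasurableEquiv.image_eq_preimage_symm,
    (volume_preserving_appendMeasurableEquiv.symm _).measure_preimage_equiv,
    Measure.volume_eq_prod, Measure.prod_prod]

/-! ### The stub -/

/-- STUB (seat c14, cycle 3). **Catalytic domain additivity descends**: a domain-additivity instance
among `P n r, P n r₁, P n r₂` (union of domains, null overlap, integrands agreeing on the pieces)
descends to `[r] − [r₁] − [r₂] ∈ relations` (indeed a domain-additivity instance among the bases: slice
the domains at a catalyst point, cancel the non-zero volume of the catalyst domain in the null overlap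
`vol (K × (σ₁ ∩ σ₂)) = vol K · vol (σ₁ ∩ σ₂)`, and read the integrand identities at a catalyst point
where `p.integrand ≠ 0`). [cite: KontsevichZagier2001, §1.2 rule (1)] -/
theorem stub_catalyticDomainAdd {d : ℕ} (p : IntegralRep d) (hp : p.value ≠ 0)
    (P : ∀ n : ℕ, IntegralRep n → IntegralRep (d + n))
    (hPd : ∀ (n : ℕ) (r : IntegralRep n), (P n r).domain =
      {z | (fun i => z (Fin.castAdd n i)) ∈ p.domain ∧ (fun j => z (Fin.natAdd d j)) ∈ r.domain})
    (hPi : ∀ (n : ℕ) (r : IntegralRep n), (P n r).integrand =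
      fun z => p.integrand (fun i => z (Fin.castAdd n i)) * r.integrand (fun j => z (Fin.natAdd d j)))
    {n : ℕ} (r r₁ r₂ : IntegralRep n)
    (hdom : (P n r).domain = (P n r₁).domain ∪ (P n r₂).domain)
    (hnull : MeasureTheory.volume ((P n r₁).domain ∩ (P n r₂).domain) = 0)
    (h₁ : Set.EqOn (P n r).integrand (P n r₁).integrand (P n r₁).domain)
    (h₂ : Set.EqOn (P n r).integrand (P n r₂).integrand (P n r₂).domain) :
    of r - of r₁ - of r₂ ∈ relations := by
  -- a catalyst point `x₀ ∈ K` with `p.integrand x₀ ≠ 0`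
  obtain ⟨x₀, hx₀, -, hc₀⟩ := stub_catalyst_algebraicPoint p hp
  -- membership in the pinned product domains
  have hmem : ∀ (s : IntegralRep n) (z : Fin (d + n) → ℝ), z ∈ (P n s).domain ↔
      (fun i => z (Fin.castAdd n i)) ∈ p.domain ∧ (fun j => z (Fin.natAdd d j)) ∈ s.domain :=
    fun s z => by rw [hPd]; rfl
  -- the slice of a cylinder at the catalyst point `x₀`
  have happ : ∀ (s : IntegralRep n) (w : Fin n → ℝ),
      Fin.append x₀ w ∈ (P n s).domain ↔ w ∈ s.domain := fun s w => by
    rw [hmem]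
    simp [hx₀]
  -- the pinned integrand at a point of the slice
  have hint : ∀ (s : IntegralRep n) (w : Fin n → ℝ),
      (P n s).integrand (Fin.append x₀ w) = p.integrand x₀ * s.integrand w := fun s w => by
    rw [hPi]
    simp
  refine domainAddRel_subset_relations ⟨n, r, r₁, r₂, ?_, ?_, ?_, ?_, rfl⟩
  · -- union of the base domains: slice `hdom` at `x₀`
    ext w
    have h := happ r w
    rw [hdom, mem_union, happ r₁ w, happ r₂ w] at h
    rw [← h, mem_union]
  · -- null overlap of the bases: the overlap upstairs is the cylinder `K × (σ₁ ∩ σ₂)`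
    have hcyl : (P n r₁).domain ∩ (P n r₂).domain =
        appendMeasurableEquiv d n '' (p.domain ×ˢ (r₁.domain ∩ r₂.domain)) := by
      ext z
      simp only [mem_inter_iff, fibreAE_mem_image_prod, hmem]
      tauto
    rw [hcyl, catalyticDomainAdd_volume_image_prod] at hnull
    exact (mul_eq_zero.mp hnull).resolve_left (catalyticDomainAdd_volume_domain_ne_zero p hp)
  · -- the integrands agree on `σ₁`: read `h₁` at `Fin.append x₀ w` and cancel `p.integrand x₀`
    intro w hw
    have h := h₁ ((happ r₁ w).mpr hw)
    rw [hint r, hint r₁] at h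
    exact mul_left_cancel₀ hc₀ h
  · -- the integrands agree on `σ₂`
    intro w hw
    have h := h₂ ((happ r₂ w).mpr hw)
    rw [hint r, hint r₂] at h
    exact mul_left_cancel₀ hc₀ h

end Summit.KontsevichZagierPeriods.KontsevichZagierPeriods.BetaCancellationLine

end
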